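import Mathlib
import Literature.Computability.AlgebraicComplexity.ArithCircuitProofs
import Literature.Computability.AlgebraicComplexity.CollisionIdeal
import Literature.Computability.AlgebraicComplexity.SyndromePolynomial
import Literature.Analysis.Complex.WeierstrassPreparation

/-!
# Route ForgivenCollisions — lemmas for item `SyndromeUpperBound` (stmt-ValiantsHypothesis-11571)

Helper file (`--supports stmt-ValiantsHypothesis-11571`) for
`Summits/ValiantsHypothesis/ValiantsHypothesis/Theorems/ForgivenCollisionsSyndromeUpperBound.lean`,
in the tree's vocabulary (`syndromePoly`, `syndromeMaps`, `collisionIdeal`, `IsCollisionBad`,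
`complexity`):

* **A. Separating labellings give representatives.** If `g : Fin n → G` (abelian group) has
  `∑_A g ≠ ∑_B g` for all disjoint `A, B` with `|A| = |B| ∈ [1, r-1]`, then
  `syndromePoly k g - per_n ∈ J_r(n)` (`syndromePoly_sub_perPoly_mem_collisionIdeal`; this is the
  content of the route item `SyndromeRepresentative`): a selected non-bijective map `τ` has
  either a column hit `≥ 3` times (bad), or doubled columns `D` and empty columns `E` with
  `|D| = |E| = q ≥ 1` and `∑_D g = ∑_E g` (the syndrome is `∑_c #τ⁻¹(c) • g c`), so `q ≥ r`
  doubled columns (bad).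
* **B. Power sums separate.** For a prime `p ≥ n` the labelling
  `g c = ((c : ZMod p)^1, …, (c : ZMod p)^m)` separates disjoint equal-size sets of size `≤ m`
  (`powerSum_label_separates`): equal power sums `p_1, …, p_q` of two `q`-element multisets of a
  field in which `1, …, q ≠ 0` force equal elementary symmetric functions (Newton's identities,
  the tree's `Literature.Analysis.Complex.SCV.natCast_mul_esymm_eq_sum`, imported from
  `WeierstrassPreparation.lean`), hence equal multisets (Vieta and
  `Polynomial.roots_multiset_prod_X_sub_C`; `multiset_eq_of_powerSum_eq`).
* **C. Cost of the character expansion.** By `syndromePoly_eq_smul_sum_addChar`,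
  `f_g = |G|⁻¹ • ∑_χ χ(-s) • ∏_i ∑_j χ(g j) • X_{ij}`; the subadditive cost calculus
  (`complexity_finset_sum_le`, `complexity_finset_prod_le`, `complexity_smul_le`) gives
  `complexity f_g ≤ |G| (2n² + n + 2) + 1` (`complexity_syndromePoly_le`).

References: Bose–Chowla / BCH power-sum syndromes [doi:10.1007/BF02566968],
[doi:10.1016/0196-6774(86)90019-2]; Bürgisser 2000, Def. 2.1 / §2.1 (the measure and its cost
calculus); Pratt 2019, Thm. 53 and Glynn 2010 (character expansion); Bourbaki, *Algèbre* IV §6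
no. 5 (Newton's identities).
-/

noncomputable section

namespace Summit.ValiantsHypothesis.Theorems

open MvPolynomial Literature.Computability.AlgebraicComplexity
open scoped BigOperators
namespace ForgivenCollisions

/-! ### A. Separating labellings give representatives modulo `J_r(n)` -/

section Representative

variable {n : ℕ} {G : Type*} [AddCommGroup G]

/-- The column counts of a one-variable-per-row monomial sum to `n`. [folklore] -/
theorem sum_colCount_graphMonomial (τ : Fin n → Fin n) :
    ∑ c, colCount (graphMonomial τ) c = n := by
  have h := sum_label_eq_sum_colCount_smul (fun _ : Fin n => (1 : ℕ)) τ
  simp only [smul_eq_mul, mul_one, Finset.sum_const, Finset.card_univ, Fintype.card_fin] at h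
  exact h.symm

/-- **Key combinatorial step.** For a labelling `g` separating disjoint equal-size sets of sizes
`1, …, r-1`, every *non-bijective* row-to-column map with the permutation syndrome has a bad
collision profile `Bad_r`: either some column is hit `≥ 3` times, or the doubled columns `D` and
the empty columns `E` satisfy `|D| = |E| = q ≥ 1` and `∑_D g = ∑_E g`, forcing `q ≥ r`. [folklore] -/
theorem isCollisionBad_graphMonomial_of_mem_syndromeMaps {r : ℕ} {g : Fin n → G}
    (hg : ∀ A B : Finset (Fin n), Disjoint A B → A.card = B.card → 1 ≤ A.card →
      A.card + 1 ≤ r → ∑ t ∈ A, g t ≠ ∑ t ∈ B, g t)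
    {τ : Fin n → Fin n} (hτ : τ ∈ syndromeMaps g) (hbij : ¬ Function.Bijective τ) :
    IsCollisionBad r (graphMonomial τ) := by
  classical
  set m : Fin n → ℕ := fun c => colCount (graphMonomial τ) c with hm
  by_cases h3 : ∃ c, 3 ≤ m c
  · obtain ⟨c, hc⟩ := h3
    exact Or.inr (Or.inl ⟨c, hc⟩)
  have h2 : ∀ c, m c ≤ 2 := fun c => Nat.lt_succ_iff.1 (not_le.1 fun h => h3 ⟨c, h⟩)
  -- doubled and empty columns
  set D : Finset (Fin n) := Finset.univ.filter fun c => m c = 2 with hD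
  set E : Finset (Fin n) := Finset.univ.filter fun c => m c = 0 with hE
  have hsum : ∑ c, m c = n := sum_colCount_graphMonomial τ
  -- |D| = |E|
  have hcardD : D.card = ∑ c, (if m c = 2 then 1 else 0) := by
    rw [hD, Finset.card_filter]
  have hcardE : E.card = ∑ c, (if m c = 0 then 1 else 0) := by
    rw [hE, Finset.card_filter]
  have hDE : D.card = E.card := by
    have key : ∑ c, m c + E.card = ∑ c : Fin n, 1 + D.card := by
      rw [hcardD, hcardE, ← Finset.sum_add_distrib, ← Finset.sum_add_distrib]
      refine Finset.sum_congr rfl fun c _ => ?_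
      have := h2 c
      interval_cases (m c) <;> simp
    simp only [Finset.sum_const, Finset.card_univ, Fintype.card_fin, smul_eq_mul, mul_one] at key
    omega
  -- the syndrome equation gives `∑_D g = ∑_E g`
  have hsyn : ∑ i, g (τ i) = ∑ c, g c := mem_syndromeMaps.1 hτ
  rw [sum_label_eq_sum_colCount_smul g τ] at hsyn
  have hsplit : ∑ c, m c • g c + ∑ c ∈ E, g c = ∑ c, g c + ∑ c ∈ D, g c := by
    rw [hD, hE, Finset.sum_filter, Finset.sum_filter, ← Finset.sum_add_distrib,
      ← Finset.sum_add_distrib]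
    refine Finset.sum_congr rfl fun c _ => ?_
    have := h2 c
    interval_cases (m c) <;> simp [two_nsmul]
  have hDE' : ∑ c ∈ D, g c = ∑ c ∈ E, g c := by
    have : ∑ c, m c • g c = ∑ c, g c := hsyn
    rw [this] at hsplit
    exact (add_left_cancel hsplit).symm
  -- D and E are disjoint
  have hdisj : Disjoint D E := by
    rw [hD, hE, Finset.disjoint_filter]
    intro c _ h
    omega
  -- E is nonempty since τ is not surjective
  have hsurj : ¬ Function.Surjective τ := fun h =>
    hbij (Finite.surjective_iff_bijective.1 h)
  obtain ⟨c₀, hc₀⟩ : ∃ c, ∀ i, τ i ≠ c := by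
    simpa [Function.Surjective] using hsurj
  have hc₀E : c₀ ∈ E := by
    rw [hE, Finset.mem_filter]
    refine ⟨Finset.mem_univ _, ?_⟩
    show colCount (graphMonomial τ) c₀ = 0
    rw [colCount_graphMonomial, Finset.card_eq_zero, Finset.filter_eq_empty_iff]
    exact fun i _ => hc₀ i
  have hq : 1 ≤ D.card := hDE ▸ Finset.card_pos.2 ⟨c₀, hc₀E⟩
  -- either `q + 1 ≤ r` (contradiction with separation) or `r ≤ q` (bad)
  by_cases hqr : D.card + 1 ≤ r
  · exact absurd hDE' (hg D E hdisj hDE hq hqr)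
  · refine Or.inr (Or.inr ?_)
    have hDsub : D ⊆ Finset.univ.filter fun c : Fin n => 2 ≤ colCount (graphMonomial τ) c := by
      intro c hc
      rw [hD, Finset.mem_filter] at hc
      rw [Finset.mem_filter]
      exact ⟨Finset.mem_univ _, by show 2 ≤ m c; omega⟩
    have := Finset.card_le_card hDsub
    omega

variable (k : Type*) [CommRing k]

/-- **The syndrome lemma** (route item `SyndromeRepresentative`, in the tree's vocabulary): a
labelling `g` that separates disjoint equal-size column sets of sizes `1, …, r-1` yields a
representative of the permanent modulo the collision ideal, `syndromePoly k g - per_n ∈ J_r(n)`.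
[folklore] -/
theorem syndromePoly_sub_perPoly_mem_collisionIdeal {r : ℕ} {g : Fin n → G}
    (hg : ∀ A B : Finset (Fin n), Disjoint A B → A.card = B.card → 1 ≤ A.card →
      A.card + 1 ≤ r → ∑ t ∈ A, g t ≠ ∑ t ∈ B, g t) :
    syndromePoly k g - perPoly (Fin n) k ∈ collisionIdeal k r n := by
  classical
  rw [syndromePoly_eq_perPoly_add k g, add_sub_cancel_left]
  refine Ideal.sum_mem _ fun τ hτ => ?_
  rw [Finset.mem_filter] at hτ
  rw [prod_X_eq_monomial_graphMonomial]
  exact monomial_mem_collisionIdeal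
    (isCollisionBad_graphMonomial_of_mem_syndromeMaps hg hτ.1 hτ.2) 1

end Representative

/-! ### B. Power sums modulo a prime separate small disjoint sets -/

section Newton

open Finset

/-- **A multiset of `q` elements of a field is determined by its first `q` power sums, provided
`1, …, q` are nonzero in the field** (Newton's identities — the tree's multiset form
`Literature.Analysis.Complex.SCV.natCast_mul_esymm_eq_sum` of Mathlib's
`MvPolynomial.mul_esymm_eq_sum` — determine `e_1, …, e_q` recursively, then Vieta and `roots`;
Bourbaki, *Algèbre* IV §6 no. 5, Cor.). [folklore] -/
theorem multiset_eq_of_powerSum_eq {S : Type*} [Field S] {s t : Multiset S} {q : ℕ}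
    (hs : Multiset.card s = q) (ht : Multiset.card t = q)
    (hchar : ∀ j, 1 ≤ j → j ≤ q → (j : S) ≠ 0)
    (h : ∀ j, 1 ≤ j → j ≤ q → (s.map (· ^ j)).sum = (t.map (· ^ j)).sum) : s = t := by
  have hes : ∀ k, k ≤ q → s.esymm k = t.esymm k := by
    intro k
    induction k using Nat.strong_induction_on with
    | _ k ih =>
      intro hk
      rcases Nat.eq_zero_or_pos k with rfl | hkpos
      · simp [Multiset.esymm]
      have h1 := Literature.Analysis.Complex.SCV.natCast_mul_esymm_eq_sum s k
      have h2 := Literature.Analysis.Complex.SCV.natCast_mul_esymm_eq_sum t k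
      have hsum : ∑ a ∈ antidiagonal k with a.1 < k,
            (-1) ^ a.1 * s.esymm a.1 * (s.map (· ^ a.2)).sum =
          ∑ a ∈ antidiagonal k with a.1 < k,
            (-1) ^ a.1 * t.esymm a.1 * (t.map (· ^ a.2)).sum := by
        refine Finset.sum_congr rfl fun a ha => ?_
        rw [Finset.mem_filter, Finset.HasAntidiagonal.mem_antidiagonal] at ha
        rw [ih a.1 ha.2 (by omega), h a.2 (by omega) (by omega)]
      apply mul_left_cancel₀ (hchar k hkpos hk)
      rw [h1, h2, hsum]
  have hprod : (s.map fun a => Polynomial.X - Polynomial.C a).prod =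
      (t.map fun a => Polynomial.X - Polynomial.C a).prod := by
    ext k
    by_cases hk : k ≤ q
    · rw [Multiset.prod_X_sub_C_coeff s (hs ▸ hk), Multiset.prod_X_sub_C_coeff t (ht ▸ hk), hs,
        ht, hes _ (Nat.sub_le q k)]
    · rw [not_le] at hk
      have hds : (s.map fun a => Polynomial.X - Polynomial.C a).prod.natDegree < k := by
        rw [Polynomial.natDegree_multiset_prod_X_sub_C_eq_card, hs]; exact hk
      have hdt : (t.map fun a => Polynomial.X - Polynomial.C a).prod.natDegree < k := by
        rw [Polynomial.natDegree_multiset_prod_X_sub_C_eq_card, ht]; exact hk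
      rw [Polynomial.coeff_eq_zero_of_natDegree_lt hds,
        Polynomial.coeff_eq_zero_of_natDegree_lt hdt]
  have h1 := Polynomial.roots_multiset_prod_X_sub_C s
  have h2 := Polynomial.roots_multiset_prod_X_sub_C t
  rw [← h1, ← h2, hprod]

end Newton

section PowerMap

/-- **Power sums modulo a prime `p ≥ n` separate disjoint equal-size subsets of `Fin n` of size
`≤ m`** (the Bose–Chowla / BCH power-sum labelling `g c = ((c : ZMod p)^1, …, (c : ZMod p)^m)`
of the columns by `(ZMod p)^m`): if `A, B ⊆ Fin n` are disjoint with `|A| = |B| = q`,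
`1 ≤ q ≤ m`, then `∑_{a ∈ A} g a ≠ ∑_{b ∈ B} g b` — equal power sums `p_1, …, p_q`
(`q ≤ n/2 < p`) would force equal multisets of residues (Newton), and the residues of `Fin n`
are distinct for `p ≥ n`. [folklore] -/
theorem powerSum_label_separates {p m n : ℕ} (hp : p.Prime) (hpn : n ≤ p)
    {g : Fin n → Fin m → ZMod p} (hg : ∀ t k, g t k = ((t : ℕ) : ZMod p) ^ ((k : ℕ) + 1))
    (A B : Finset (Fin n)) (hAB : Disjoint A B) (hcard : A.card = B.card) (h1 : 1 ≤ A.card)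
    (hm : A.card ≤ m) :
    ∑ t ∈ A, g t ≠ ∑ t ∈ B, g t := by
  classical
  haveI : Fact p.Prime := ⟨hp⟩
  intro hEq
  -- 2q ≤ n ≤ p, so q < p
  have h2q : A.card + A.card ≤ n := by
    have := Finset.card_union_of_disjoint hAB
    have hle : (A ∪ B).card ≤ n := (Finset.card_le_univ _).trans_eq (Fintype.card_fin n)
    omega
  have hqp : A.card < p := by omega
  -- the residue map and the residue multisets of `A` and `B`
  have hchar : ∀ j, 1 ≤ j → j ≤ A.card → (j : ZMod p) ≠ 0 := by
    intro j hj hjq h0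
    rw [ZMod.natCast_eq_zero_iff] at h0
    exact absurd (Nat.le_of_dvd (by omega) h0) (by omega)
  have hsu : A.val.map (fun t : Fin n => ((t : ℕ) : ZMod p)) =
      B.val.map (fun t : Fin n => ((t : ℕ) : ZMod p)) := by
    refine multiset_eq_of_powerSum_eq (q := A.card) ?_ ?_ hchar ?_
    · rw [Multiset.card_map, Finset.card_val]
    · rw [Multiset.card_map, Finset.card_val]; exact hcard.symm
    · intro j hj hjq
      have hk : j - 1 < m := by omega
      have h := congrFun hEq ⟨j - 1, hk⟩
      simp only [Finset.sum_apply, hg] at h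
      rw [show j - 1 + 1 = j by omega, Finset.sum_eq_multiset_sum,
        Finset.sum_eq_multiset_sum] at h
      rw [Multiset.map_map, Multiset.map_map]
      exact h
  -- pick an element of A; its residue lies in the residues of B, hence comes from B
  obtain ⟨a, ha⟩ := Finset.card_pos.1 (by omega : 0 < A.card)
  have has : ((a : ℕ) : ZMod p) ∈ A.val.map (fun t : Fin n => ((t : ℕ) : ZMod p)) :=
    Multiset.mem_map_of_mem _ (Finset.mem_def.1 ha)
  rw [hsu, Multiset.mem_map] at has
  obtain ⟨b, hb, hab⟩ := has
  have hab' : (b : ℕ) = (a : ℕ) := by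
    have h := (ZMod.natCast_eq_natCast_iff' (b : ℕ) (a : ℕ) p).1 hab
    rwa [Nat.mod_eq_of_lt (lt_of_lt_of_le b.isLt hpn),
      Nat.mod_eq_of_lt (lt_of_lt_of_le a.isLt hpn)] at h
  have hba : b = a := Fin.ext hab'
  rw [hba] at hb
  exact Finset.disjoint_left.1 hAB ha (Finset.mem_def.2 hb)

end PowerMap

/-! ### C. The cost of the character expansion -/

section Cost

variable {n : ℕ} {G : Type*} [AddCommGroup G]

/-- One character term `∏_i ∑_j χ(g j) • X_{ij}` costs at most `2n² + n` gates: each weighted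
variable one gate, each row sum `n` more, the product `n` more (subadditive cost calculus,
Bürgisser 2000, §2.1). [folklore] -/
theorem complexity_prod_sum_smul_X_le (χ : AddChar G ℂ) (g : Fin n → G) :
    complexity (∏ i : Fin n, ∑ j : Fin n, χ (g j) • (X (i, j) : MvPolynomial (Fin n × Fin n) ℂ))
      ≤ n * (2 * n) + n := by
  have hterm : ∀ i j : Fin n,
      complexity (χ (g j) • (X (i, j) : MvPolynomial (Fin n × Fin n) ℂ)) ≤ 1 := by
    intro i j
    calc complexity (χ (g j) • (X (i, j) : MvPolynomial (Fin n × Fin n) ℂ))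
        ≤ complexity (X (i, j) : MvPolynomial (Fin n × Fin n) ℂ) + 1 :=
          complexity_smul_le_holds _ _
      _ = 1 := by rw [complexity_X_holds]
  have hrow : ∀ i : Fin n,
      complexity (∑ j : Fin n, χ (g j) • (X (i, j) : MvPolynomial (Fin n × Fin n) ℂ)) ≤ 2 * n := by
    intro i
    calc complexity (∑ j : Fin n, χ (g j) • (X (i, j) : MvPolynomial (Fin n × Fin n) ℂ))
        ≤ ∑ j : Fin n, complexity (χ (g j) • (X (i, j) : MvPolynomial (Fin n × Fin n) ℂ)) +
            (Finset.univ : Finset (Fin n)).card := complexity_finset_sum_le _ _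
      _ ≤ ∑ _j : Fin n, 1 + (Finset.univ : Finset (Fin n)).card := by
          gcongr with j _
          exact hterm i j
      _ = 2 * n := by simp; ring
  calc complexity (∏ i : Fin n, ∑ j : Fin n, χ (g j) • (X (i, j) : MvPolynomial (Fin n × Fin n) ℂ))
      ≤ ∑ i : Fin n, complexity (∑ j : Fin n, χ (g j) •
          (X (i, j) : MvPolynomial (Fin n × Fin n) ℂ)) + (Finset.univ : Finset (Fin n)).card :=
        complexity_finset_prod_le _ _
    _ ≤ ∑ _i : Fin n, 2 * n + (Finset.univ : Finset (Fin n)).card := by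
        gcongr with i _
        exact hrow i
    _ = n * (2 * n) + n := by simp

variable [Fintype G]

/-- **Cost of the character expansion**: for a finite abelian `G` and any labelling `g`,
`complexity (syndromePoly ℂ g) ≤ |G| · (2n² + n + 2) + 1` — `|G|` character terms of cost
`≤ 2n² + n + 1` each (term plus one scalar gate), `|G|` addition gates, one final scalar gate
(Pratt 2019, proof of Thm. 53, costed with Bürgisser's subadditive calculus). [folklore] -/
theorem complexity_syndromePoly_le (g : Fin n → G) :
    complexity (syndromePoly ℂ g) ≤ Fintype.card G * (n * (2 * n) + n + 2) + 1 := by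
  classical
  rw [syndromePoly_eq_smul_sum_addChar g]
  have hterm : ∀ χ : AddChar G ℂ,
      complexity (χ (-(∑ c, g c)) • ∏ i : Fin n, ∑ j : Fin n,
        χ (g j) • (X (i, j) : MvPolynomial (Fin n × Fin n) ℂ)) ≤ n * (2 * n) + n + 1 := by
    intro χ
    calc complexity (χ (-(∑ c, g c)) • ∏ i : Fin n, ∑ j : Fin n,
          χ (g j) • (X (i, j) : MvPolynomial (Fin n × Fin n) ℂ))
        ≤ complexity (∏ i : Fin n, ∑ j : Fin n,
            χ (g j) • (X (i, j) : MvPolynomial (Fin n × Fin n) ℂ)) + 1 :=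
          complexity_smul_le_holds _ _
      _ ≤ n * (2 * n) + n + 1 := by
          gcongr
          exact complexity_prod_sum_smul_X_le χ g
  have hsum : complexity (∑ χ : AddChar G ℂ, χ (-(∑ c, g c)) • ∏ i : Fin n, ∑ j : Fin n,
        χ (g j) • (X (i, j) : MvPolynomial (Fin n × Fin n) ℂ)) ≤
      Fintype.card G * (n * (2 * n) + n + 2) := by
    calc complexity (∑ χ : AddChar G ℂ, χ (-(∑ c, g c)) • ∏ i : Fin n, ∑ j : Fin n,
          χ (g j) • (X (i, j) : MvPolynomial (Fin n × Fin n) ℂ))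
        ≤ ∑ χ : AddChar G ℂ, complexity (χ (-(∑ c, g c)) • ∏ i : Fin n, ∑ j : Fin n,
            χ (g j) • (X (i, j) : MvPolynomial (Fin n × Fin n) ℂ)) +
            (Finset.univ : Finset (AddChar G ℂ)).card := complexity_finset_sum_le _ _
      _ ≤ ∑ _χ : AddChar G ℂ, (n * (2 * n) + n + 1) +
            (Finset.univ : Finset (AddChar G ℂ)).card := by
          gcongr with χ _
          exact hterm χ
      _ = Fintype.card G * (n * (2 * n) + n + 2) := by
          simp only [Finset.sum_const, Finset.card_univ, smul_eq_mul, AddChar.card_eq]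
          ring
  calc complexity ((Fintype.card G : ℂ)⁻¹ • ∑ χ : AddChar G ℂ, χ (-(∑ c, g c)) •
        ∏ i : Fin n, ∑ j : Fin n, χ (g j) • (X (i, j) : MvPolynomial (Fin n × Fin n) ℂ))
      ≤ complexity (∑ χ : AddChar G ℂ, χ (-(∑ c, g c)) • ∏ i : Fin n, ∑ j : Fin n,
          χ (g j) • (X (i, j) : MvPolynomial (Fin n × Fin n) ℂ)) + 1 :=
        complexity_smul_le_holds _ _
    _ ≤ Fintype.card G * (n * (2 * n) + n + 2) + 1 := by gcongr

end Cost

end ForgivenCollisions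

end Summit.ValiantsHypothesis.Theorems
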